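import Summits.ABC.ABC.Theorems.AbcExplicitW80EngineThreeModFour
import Summits.ABC.ABC.Theorems.AbcExplicitW80EngineOneModFour
import Summits.ABC.ABC.Theorems.AbcExplicitW80EngineTwo
import Summits.ABC.ABC.Theorems.AbcExplicitW80TransferOdd
import Summits.ABC.ABC.Theorems.AbcExplicitW80TransferTwo
import Summits.ABC.ABC.Theorems.AbcExplicitTwoThirdsDoor
import HarnessLib

/-!
# An EXPLICIT constant for Stewart–Yu 1991: `log c ≤ κ(ε) · rad(abc)^{2/3+ε}` (papers lane ABC-P1, writer seat; theorems only)

`Summits/ABC/ABC/Theorems/AbcExplicitTwoThirds.lean`.  The rung `stewartYu1991_holds : stewartYu1991_upperBound` (p447866)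
is the `∃ κ c₀`-statement; its proof cone instantiates every existential by an explicit term, but through five
`∃`-packaged interfaces (three engines, two transfers) and the `∃`-door.  With those interfaces re-run with the
existentials opened (`AbcExplicitW80Engine{ThreeModFour,OneModFour,Two}`, `AbcExplicitW80Transfer{Odd,Two}`,
`AbcExplicitTwoThirdsDoor`, all verbatim copies of the cell's proofs), this file composes them BY NAME:

* `w80Shape_threeModFour_explicit`, `w80Shape_oneModFour_explicit`, `w80Shape_two_explicit` — the Waldschmidt-shape
  one-prime texts of the three residue classes with the constants `c₅ = 41·2^70`, `41·2^71`, `25·(3·2^70)` in the statements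
  (engines `C(m) = 2·Cw m`, `2·(2·Cw m)`, `3·(2·Cw m)`, envelopes `c₁ = 2^70, 2^71, 3·2^70`; `Cw m = (2^69 m)^m`);
* `w80Shape_allPrimes_explicit` — the text at EVERY prime with the common constant `c₅ = 41·2^71` (monotonicity in `c₅`,
  as in the route's `closes`);
* `abc_log_le_explicit_mul_rad_pow_twoThirds_add_raw` / `abc_log_le_explicit_mul_rad_pow_twoThirds_add` — for every `ε > 0` and
  every abc triple with `c ≥ 3`:  `log c ≤ κ(ε) · rad(abc)^{2/3+ε}` with the CLOSED TERM
  `κ(ε) = (6 · (23040000 · D^{⌈D^{1/δ}⌉} · (12/δ)^{12})^{1/3} / δ)^{1/(1−δ)}`, `δ = min(1/2, 3ε/8)`, `D = (24600·2^73)^2`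
  (a double exponential in `1/ε`: `log₁₀ log₁₀ κ(ε) ≈ 140.6/ε + 1.2` for `ε ≤ 4/3` — a PAPER-ONLY evaluation; no arithmetical
  use is claimed).  The leaf `stewartYu1991_upperBound` follows from it with `c₀ = 3` (not restated here: it is the landed
  `stewartYu1991_holds`).

No new definition; [folklore] bookkeeping on landed theorems.  WHAT THIS IS NOT: not the uniform Math. Ann. 291 theorem
`log z < G^{2/3 + c/log log G}`; not a new estimate; the constant is the kernel development's own, chosen for provability.
-/

set_option linter.dupNamespace false

noncomputable section

open Finset Real Height
open Literature.NumberTheory.DiophantineGeometry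
open Literature.Barriers.ABC

namespace Summit.ABC.ABC.Theorems

open Summit.ABC.StewartYu

/-- **The Waldschmidt-shape text at `p ≡ 3 (mod 4)` with `c₅ = 41·2^70`** (engine `engineThreeModFourW80_explicit`,
`C(m) = 2·Cw m ≤ (2^70)^m m^m`, transfer `residueClass_of_w80Engine_explicit`). [folklore] -/
theorem w80Shape_threeModFour_explicit :
    ∀ (p : ℕ), p.Prime → p % 4 = 3 → ∀ (S : Finset ℕ), (∀ q ∈ S, q.Prime) → p ∉ S →
      S.Nonempty → ∀ (e : ℕ → ℤ) (B : ℝ), 3 ≤ B → (∀ q ∈ S, (|e q| : ℝ) ≤ B) →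
      ∏ q ∈ S, (q : ℚ) ^ e q ≠ 1 →
      (padicValRat p (∏ q ∈ S, (q : ℚ) ^ e q - 1) : ℝ) <
        (41 * 2 ^ 70 * S.card) ^ S.card * (p : ℝ) ^ 2 *
          ((Real.log B + Real.log (Real.log ((max 4 (S.sup id) : ℕ) : ℝ))) *
            Real.log (Real.log ((max 4 (S.sup id) : ℕ) : ℝ))) *
          ∏ q ∈ S, Real.log ((max 4 q : ℕ) : ℝ) :=
  YuNinetyW80.residueClass_of_w80Engine_explicit (fun p => p % 4 = 3) (by norm_num)
    (C := fun m => 2 * PadicW80Par.Cw m) (c₁ := 2 ^ 70) (by norm_num)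
    (fun m hm => ⟨by have := PadicW80Par.two_le_Cw hm; change (0 : ℝ) ≤ 2 * PadicW80Par.Cw m; linarith,
      TwistSetup.two_mul_Cw_le_pow hm⟩)
    TwistSetup.engineThreeModFourW80_explicit

/-- **The Waldschmidt-shape text at `p ≡ 1 (mod 4)` with `c₅ = 41·2^71`** (engine `engineOneModFourW80_explicit`,
`2·(2·Cw m) ≤ (2^71)^m m^m`, transfer `residueClass_of_w80Engine_explicit`). [folklore] -/
theorem w80Shape_oneModFour_explicit :
    ∀ (p : ℕ), p.Prime → p % 4 = 1 → ∀ (S : Finset ℕ), (∀ q ∈ S, q.Prime) → p ∉ S →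
      S.Nonempty → ∀ (e : ℕ → ℤ) (B : ℝ), 3 ≤ B → (∀ q ∈ S, (|e q| : ℝ) ≤ B) →
      ∏ q ∈ S, (q : ℚ) ^ e q ≠ 1 →
      (padicValRat p (∏ q ∈ S, (q : ℚ) ^ e q - 1) : ℝ) <
        (41 * 2 ^ 71 * S.card) ^ S.card * (p : ℝ) ^ 2 *
          ((Real.log B + Real.log (Real.log ((max 4 (S.sup id) : ℕ) : ℝ))) *
            Real.log (Real.log ((max 4 (S.sup id) : ℕ) : ℝ))) *
          ∏ q ∈ S, Real.log ((max 4 q : ℕ) : ℝ) := by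
  refine YuNinetyW80.residueClass_of_w80Engine_explicit (fun p => p % 4 = 1) (by norm_num)
    (C := fun m => 2 * (2 * PadicW80Par.Cw m)) (c₁ := 2 ^ 71) (by norm_num) (fun m hm => ⟨?_, ?_⟩)
    TwistSetup.engineOneModFourW80_explicit
  · have := PadicW80Par.two_le_Cw hm
    change (0 : ℝ) ≤ 2 * (2 * PadicW80Par.Cw m)
    linarith
  · have h := TwistSetup.two_mul_Cw_le_pow hm
    have h2 : (2 : ℝ) ≤ 2 ^ m := by
      calc (2 : ℝ) = 2 ^ 1 := (pow_one _).symm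
        _ ≤ 2 ^ m := pow_le_pow_right₀ (by norm_num) hm
    have h0 : (0 : ℝ) ≤ (2 ^ 70 : ℝ) ^ m * (m : ℝ) ^ m := by positivity
    change 2 * (2 * PadicW80Par.Cw m) ≤ (2 ^ 71 : ℝ) ^ m * (m : ℝ) ^ m
    calc 2 * (2 * PadicW80Par.Cw m) ≤ 2 * ((2 ^ 70 : ℝ) ^ m * (m : ℝ) ^ m) := by linarith
      _ ≤ 2 ^ m * ((2 ^ 70 : ℝ) ^ m * (m : ℝ) ^ m) := mul_le_mul_of_nonneg_right h2 h0
      _ = (2 ^ 71 : ℝ) ^ m * (m : ℝ) ^ m := by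
          rw [show (2 ^ 71 : ℝ) = 2 * 2 ^ 70 by norm_num, mul_pow]; ring

/-- **The Waldschmidt-shape text at `p = 2` with `c₅ = 25·(3·2^70)`** (engine `engineTwoW80_explicit`,
`3·(2·Cw m) ≤ (3·2^70)^m m^m`, transfer `two_of_w80Engine_int_explicit`). [folklore] -/
theorem w80Shape_two_explicit :
    ∀ (S : Finset ℕ), (∀ q ∈ S, q.Prime) → 2 ∉ S → S.Nonempty → ∀ (e : ℕ → ℤ) (B : ℝ),
      3 ≤ B → (∀ q ∈ S, (|e q| : ℝ) ≤ B) → ∏ q ∈ S, (q : ℚ) ^ e q ≠ 1 →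
      (padicValRat 2 (∏ q ∈ S, (q : ℚ) ^ e q - 1) : ℝ) <
        (25 * (3 * 2 ^ 70) * S.card) ^ S.card * (2 : ℝ) ^ 2 *
          ((Real.log B + Real.log (Real.log ((max 4 (S.sup id) : ℕ) : ℝ))) *
            Real.log (Real.log ((max 4 (S.sup id) : ℕ) : ℝ))) *
          ∏ q ∈ S, Real.log ((max 4 q : ℕ) : ℝ) := by
  refine YuNinetyW80.two_of_w80Engine_int_explicit
    (C := fun m => 3 * (2 * PadicW80Par.Cw m)) (c₁ := 3 * 2 ^ 70) (by norm_num) (fun m hm => ⟨?_, ?_⟩)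
    TwoSetup.engineTwoW80_explicit
  · have := PadicW80Par.two_le_Cw hm
    change (0 : ℝ) ≤ 3 * (2 * PadicW80Par.Cw m)
    linarith
  · have h := TwistSetup.two_mul_Cw_le_pow hm
    have h3 : (3 : ℝ) ≤ 3 ^ m := by
      calc (3 : ℝ) = 3 ^ 1 := (pow_one _).symm
        _ ≤ 3 ^ m := pow_le_pow_right₀ (by norm_num) hm
    have h0 : (0 : ℝ) ≤ (2 ^ 70 : ℝ) ^ m * (m : ℝ) ^ m := by positivity
    change 3 * (2 * PadicW80Par.Cw m) ≤ (3 * 2 ^ 70 : ℝ) ^ m * (m : ℝ) ^ m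
    calc 3 * (2 * PadicW80Par.Cw m) ≤ 3 * ((2 ^ 70 : ℝ) ^ m * (m : ℝ) ^ m) := by linarith
      _ ≤ 3 ^ m * ((2 ^ 70 : ℝ) ^ m * (m : ℝ) ^ m) := mul_le_mul_of_nonneg_right h3 h0
      _ = (3 * 2 ^ 70 : ℝ) ^ m * (m : ℝ) ^ m := by rw [mul_pow]; ring

/-- **The Waldschmidt-shape text at EVERY prime with the common constant `c₅ = 41·2^71`** (`= max(41·2^70, 41·2^71,
75·2^70)`; the tail of the bound is non-negative, so each class constant may be enlarged — the argument of the route's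
`PadicPrimesW80TwoThirds.closes`, with numerals). [folklore] -/
theorem w80Shape_allPrimes_explicit :
    ∀ (p : ℕ), p.Prime → ∀ (S : Finset ℕ), (∀ q ∈ S, q.Prime) → p ∉ S → S.Nonempty →
      ∀ (e : ℕ → ℤ) (B : ℝ), 3 ≤ B → (∀ q ∈ S, (|e q| : ℝ) ≤ B) →
      ∏ q ∈ S, (q : ℚ) ^ e q ≠ 1 →
      (padicValRat p (∏ q ∈ S, (q : ℚ) ^ e q - 1) : ℝ) <
        (41 * 2 ^ 71 * S.card) ^ S.card * (p : ℝ) ^ 2 *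
          ((Real.log B + Real.log (Real.log ((max 4 (S.sup id) : ℕ) : ℝ))) *
            Real.log (Real.log ((max 4 (S.sup id) : ℕ) : ℝ))) *
          ∏ q ∈ S, Real.log ((max 4 q : ℕ) : ℝ) := by
  intro p hp S hS hpS hne e B hB heB hne1
  -- the tail of the bound is non-negative, so the constant may be enlarged
  have h4 : (4 : ℝ) ≤ ((max 4 (S.sup id) : ℕ) : ℝ) := by exact_mod_cast le_max_left _ _
  have hlog4 : (1 : ℝ) ≤ Real.log ((max 4 (S.sup id) : ℕ) : ℝ) := by
    have he : Real.exp 1 ≤ 4 := by have := Real.exp_one_lt_d9; linarith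
    calc (1 : ℝ) = Real.log (Real.exp 1) := (Real.log_exp 1).symm
      _ ≤ Real.log 4 := Real.log_le_log (Real.exp_pos 1) he
      _ ≤ _ := Real.log_le_log (by norm_num) h4
  have hT : 0 ≤ (p : ℝ) ^ 2 * ((Real.log B + Real.log (Real.log ((max 4 (S.sup id) : ℕ) : ℝ))) *
      Real.log (Real.log ((max 4 (S.sup id) : ℕ) : ℝ))) * ∏ q ∈ S, Real.log ((max 4 q : ℕ) : ℝ) := by
    have hB' : 0 ≤ Real.log B := Real.log_nonneg (by linarith)
    have hLL : 0 ≤ Real.log (Real.log ((max 4 (S.sup id) : ℕ) : ℝ)) := Real.log_nonneg hlog4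
    have hP : 0 ≤ ∏ q ∈ S, Real.log ((max 4 q : ℕ) : ℝ) :=
      Finset.prod_nonneg fun q _ => Real.log_nonneg (by exact_mod_cast le_max_of_le_left (by norm_num))
    positivity
  have mono : ∀ c : ℝ, |c| ≤ 41 * 2 ^ 71 → ∀ v : ℝ,
      v < (c * S.card) ^ S.card * (p : ℝ) ^ 2 * ((Real.log B + Real.log (Real.log ((max 4 (S.sup id) : ℕ) : ℝ))) *
        Real.log (Real.log ((max 4 (S.sup id) : ℕ) : ℝ))) * ∏ q ∈ S, Real.log ((max 4 q : ℕ) : ℝ) →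
      v < (41 * 2 ^ 71 * S.card) ^ S.card * (p : ℝ) ^ 2 *
        ((Real.log B + Real.log (Real.log ((max 4 (S.sup id) : ℕ) : ℝ))) *
          Real.log (Real.log ((max 4 (S.sup id) : ℕ) : ℝ))) * ∏ q ∈ S, Real.log ((max 4 q : ℕ) : ℝ) := by
    intro c hc v hv
    have hpow : (c * S.card) ^ S.card ≤ (41 * 2 ^ 71 * S.card) ^ S.card := by
      calc (c * S.card) ^ S.card ≤ |(c * S.card) ^ S.card| := le_abs_self _
        _ = (|c| * S.card) ^ S.card := by rw [abs_pow, abs_mul, Nat.abs_cast]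
        _ ≤ _ := pow_le_pow_left₀ (by positivity)
              (mul_le_mul_of_nonneg_right hc (Nat.cast_nonneg _)) _
    refine lt_of_lt_of_le hv ?_
    have := mul_le_mul_of_nonneg_right hpow hT
    calc (c * S.card) ^ S.card * (p : ℝ) ^ 2 * ((Real.log B + Real.log (Real.log ((max 4 (S.sup id) : ℕ) : ℝ))) *
          Real.log (Real.log ((max 4 (S.sup id) : ℕ) : ℝ))) * ∏ q ∈ S, Real.log ((max 4 q : ℕ) : ℝ)
        = (c * S.card) ^ S.card * ((p : ℝ) ^ 2 * ((Real.log B + Real.log (Real.log ((max 4 (S.sup id) : ℕ) : ℝ))) *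
          Real.log (Real.log ((max 4 (S.sup id) : ℕ) : ℝ))) * ∏ q ∈ S, Real.log ((max 4 q : ℕ) : ℝ)) := by
          ring
      _ ≤ (41 * 2 ^ 71 * S.card) ^ S.card * ((p : ℝ) ^ 2 *
          ((Real.log B + Real.log (Real.log ((max 4 (S.sup id) : ℕ) : ℝ))) *
            Real.log (Real.log ((max 4 (S.sup id) : ℕ) : ℝ))) * ∏ q ∈ S, Real.log ((max 4 q : ℕ) : ℝ)) :=
          this
      _ = _ := by ring
  rcases hp.eq_two_or_odd with hp2 | hodd
  · subst hp2
    have h := w80Shape_two_explicit S hS hpS hne e B hB heB hne1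
    refine mono (25 * (3 * 2 ^ 70)) (by norm_num) _ ?_
    simpa only [Nat.cast_ofNat] using h
  · have h13 : p % 4 = 1 ∨ p % 4 = 3 := by omega
    rcases h13 with h1 | h3
    · exact mono (41 * 2 ^ 71) (by norm_num) _
        (w80Shape_oneModFour_explicit p hp h1 S hS hpS hne e B hB heB hne1)
    · exact mono (41 * 2 ^ 70) (by norm_num) _
        (w80Shape_threeModFour_explicit p hp h3 S hS hpS hne e B hB heB hne1)

/-- **Stewart–Yu 1991 with an explicit constant, raw form**: the door `abc_log_le_explicit_twoThirds_of_w80Shape` at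
`c₅ = 41·2^71`. [cite: StewartYu1991, Theorem (p. 226), "in particular" clause, as reproduced in Waldschmidt2014 §2] -/
theorem abc_log_le_explicit_mul_rad_pow_twoThirds_add_raw {ε : ℝ} (hε : 0 < ε) :
    ∀ a b c : ℕ, IsABCTriple a b c → 3 ≤ c →
      Real.log c ≤
        (6 * (23040000 *
              ((600 * (2 * max (max 1 (2 * |(41 * 2 ^ 71 : ℝ)|)) (2 ^ 70 : ℝ))) ^ 2) ^
                ⌈((600 * (2 * max (max 1 (2 * |(41 * 2 ^ 71 : ℝ)|)) (2 ^ 70 : ℝ))) ^ 2) ^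
                  (1 / min (1 / 2) (3 * ε / 8))⌉₊ *
              (12 / min (1 / 2) (3 * ε / 8)) ^ 12) ^ (1 / 3 : ℝ) /
            min (1 / 2) (3 * ε / 8)) ^ (1 / (1 - min (1 / 2) (3 * ε / 8))) *
          (rad a b c : ℝ) ^ (2 / 3 + ε : ℝ) :=
  abc_log_le_explicit_twoThirds_of_w80Shape (41 * 2 ^ 71) w80Shape_allPrimes_explicit hε

/-- **Stewart–Yu 1991, `log c ≤ κ(ε) · rad(abc)^{2/3+ε}` for every abc triple with `c ≥ 3`, with the EXPLICIT constant**
`κ(ε) = (6 · (23040000 · D^{⌈D^{1/δ}⌉} · (12/δ)^{12})^{1/3} / δ)^{1/(1−δ)}`, `δ = min(1/2, 3ε/8)`, `D = (24600·2^73)^2`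
— a closed term of `ε` alone (a double exponential in `1/ε`; `log₁₀ log₁₀ κ(ε) ≈ 140.6/ε + 1.2` for `ε ≤ 4/3`, PAPER-ONLY
evaluation).  The leaf `stewartYu1991_upperBound` (`∃ κ c₀`) is this statement with the witnesses `κ(ε)`, `c₀ = 3` hidden.
Not the uniform Math. Ann. theorem; no arithmetical use of the constant is claimed.
[cite: StewartYu1991, Theorem (p. 226), "in particular" clause, as reproduced in Waldschmidt2014 §2] -/
theorem abc_log_le_explicit_mul_rad_pow_twoThirds_add {ε : ℝ} (hε : 0 < ε) (a b c : ℕ) (ht : IsABCTriple a b c)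
    (hc : 3 ≤ c) :
    Real.log c ≤
      (6 * (23040000 *
            ((24600 * 2 ^ 73 : ℝ) ^ 2) ^ ⌈((24600 * 2 ^ 73 : ℝ) ^ 2) ^ (1 / min (1 / 2) (3 * ε / 8))⌉₊ *
            (12 / min (1 / 2) (3 * ε / 8)) ^ 12) ^ (1 / 3 : ℝ) /
          min (1 / 2) (3 * ε / 8)) ^ (1 / (1 - min (1 / 2) (3 * ε / 8))) *
        (rad a b c : ℝ) ^ (2 / 3 + ε : ℝ) := by
  have h := abc_log_le_explicit_mul_rad_pow_twoThirds_add_raw hε a b c ht hc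
  have e : (600 * (2 * max (max 1 (2 * |(41 * 2 ^ 71 : ℝ)|)) (2 ^ 70 : ℝ))) = 24600 * 2 ^ 73 := by
    have h1 : |(41 * 2 ^ 71 : ℝ)| = 41 * 2 ^ 71 := abs_of_pos (by positivity)
    rw [h1, max_eq_right (show (1 : ℝ) ≤ 2 * (41 * 2 ^ 71) by norm_num),
      max_eq_left (show (2 ^ 70 : ℝ) ≤ 2 * (41 * 2 ^ 71) by norm_num)]
    norm_num
  rw [e] at h
  exact h

end Summit.ABC.ABC.Theorems

end
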